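import Mathlib
import Literature.AlgebraicGeometry.Resolution.PointBlowupFlagMaximalShift
import Literature.AlgebraicGeometry.Resolution.WeightedShear
import Summits.ResolutionOfSingularities.ResolutionOfSingularities.Theorems.WeightedInvariantLocalWeightedDropWildPurePowerFlagDefs
import Summits.ResolutionOfSingularities.ResolutionOfSingularities.Theorems.WeightedInvariantLocalWeightedDropWildMonicWClean
import Summits.ResolutionOfSingularities.ResolutionOfSingularities.Theorems.WeightedInvariantLocalWeightedDropWildMonicShiftOrder
import Summits.ResolutionOfSingularities.ResolutionOfSingularities.Theorems.WeightedInvariantLocalWeightedDropWildMonicSCleanShift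

/-!
# `WeightedInvariant.LocalWeightedDrop`, line `hasse-ridge-face-selection`, S3ρ sub-stub S3ρD `stub_wildMonicSurfaceDescent`: item D-0
# «maximising flag» — a PLANE SHEAR ON OR ABOVE THE LINE DOES NOT LOWER THE LINE-WEIGHTED ORDER (the `h`-part of Per17 Lemma 5.3.3 (1))

Crux item stmt-ResolutionOfSingularities-8899 `LocalWeightedDrop` (route `ResolutionOfSingularities/WeightedInvariant`), engine of the door
`HypersurfaceCentreConstruction` stmt-ResolutionOfSingularities-19897.  [OURS · L1 W4.3, chain w43, res-L1-w43-stub-3 (gen 3) on roadmap item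
D-0 of `L/res-L1-w43-stub-7/S3RHOD-ROADMAP.md` (owners res-type-083 / stub-7); spec `L/res-L1-w43-stub-3/D0-SPEC.md` §8 (D-0d, case (β)).
MODEL: Perlega, arXiv:2011.14443 Ch. 5 §3 Lemma 5.3.3 (1) `s_under_double_coord_changes` (p0064 L38–L47): «if `ord h ≥ s/d!` and
`ord g_j ≥ …` then `ord J̃₋₂ ≥ ord J₋₂`» — the plane-shear half, read through res-D-pv-005 AS stub-7's dictionary
`WildMonic.natCast_le_sFlag_iff_le_wMin` (`…WildMonicSCleanShift`: `s ≤ sFlag ⟺ s·δ + w_s(r) ≤ wMin w_s A`, `w_s = ![δ!, s]`): for the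
weights `![M, N]` the shear `x₁ ↦ x₁ + h(x₀)` does not lower `ord_{![M,N]}` as soon as `N ≤ M · ord h`.  Folklore weighted-order
algebra (Mathlib's `MvPowerSeries.le_weightedOrder_subst`) on stub-1's `PurePowerFlag.shift` and res-type-083's `WildMonic.wMin`;
definition-free.]

* `le_weightedOrder_X_zero` / `le_weightedOrder_X_one` / `mul_order_le_weightedOrder_subst_X_zero` (`M · ord h ≤ ord_{![M,N]} h(x₀)`)
  / `le_weightedOrder_shift_one` (`N ≤ ord_{![M,N]} (x₁ + h(x₀))` when `N ≤ M · ord h`);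
* **`le_weightedOrder_subst_shift`** — `ord_{![M,N]} F ≤ ord_{![M,N]} F(x₀, x₁ + h(x₀))` when `N ≤ M · ord h`; **`weightedOrder_subst_shift`**
  — hence EQUALITY (the inverse shear `−h` has the same order);
* `slotWOrd_le_slotWOrd_shear`, **`wMin_le_wMin_shear`**, `slotWOrd_shear`, **`wMin_shear`** — the same for the scaled slot orders and their
  minimum `wMin` of a monic tuple sheared slotwise (the tuple half of `WildMonic.flagTuple d A g h` before re-centring);
* through stub-7's dictionary `natCast_le_sFlag_iff_le_wMin`: **`natCast_le_sFlag_shear_iff`**, `le_sFlag_shear`, **`sFlag_shear_eq`** — a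
  setting-preserving shear with `s ≤ δ!·ord h` does not lower `sFlag ≥ s`, and with `s < δ!·ord h` preserves a finite `sFlag = s`.
-/

set_option linter.dupNamespace false -- mandated namespace of this single-conjunct summit

namespace Summit.ResolutionOfSingularities.ResolutionOfSingularities.Theorems

namespace WildMonic

open MvPowerSeries
open Literature.AlgebraicGeometry.Resolution

variable {k : Type} [Field k]

/-! ### Weighted orders of the letters and of `h(x₀)` -/

/-- `M ≤ ord_{![M,N]}(x₀)`. -/
theorem le_weightedOrder_X_zero (M N : ℕ) : (M : ℕ∞) ≤ weightedOrder ![M, N] (X (0 : Fin 2) : MvPowerSeries (Fin 2) k) := by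
  refine nat_le_weightedOrder _ fun e he => ?_
  rw [coeff_X]
  split_ifs with h1
  · exfalso
    rw [h1, WeightedShear.weight_fin_two] at he
    simp at he
  · rfl

/-- `N ≤ ord_{![M,N]}(x₁)`. -/
theorem le_weightedOrder_X_one (M N : ℕ) : (N : ℕ∞) ≤ weightedOrder ![M, N] (X (1 : Fin 2) : MvPowerSeries (Fin 2) k) := by
  refine nat_le_weightedOrder _ fun e he => ?_
  rw [coeff_X]
  split_ifs with h1
  · exfalso
    rw [h1, WeightedShear.weight_fin_two] at he
    simp at he
  · rfl

/-- `M · ord h ≤ ord_{![M,N]}(h(x₀))`: a one-variable series of order `n` put in the letter `x₀` has line weight at least `M·n`. -/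
theorem mul_order_le_weightedOrder_subst_X_zero (M N : ℕ) (h : PowerSeries k) :
    (M : ℕ∞) * h.order ≤ weightedOrder ![M, N] (PowerSeries.subst (X (0 : Fin 2) : MvPowerSeries (Fin 2) k) h) := by
  have hX : PowerSeries.HasSubst (X (0 : Fin 2) : MvPowerSeries (Fin 2) k) := PowerSeries.HasSubst.X 0
  obtain ⟨h', hh'⟩ := PowerSeries.X_pow_order_dvd (φ := h)
  by_cases h0 : h = 0
  · rw [h0, ← PowerSeries.coe_substAlgHom hX, map_zero, weightedOrder_zero]
    exact le_top
  have hfin : h.order ≠ ⊤ := by rwa [ne_eq, PowerSeries.order_eq_top]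
  conv_rhs => rw [hh']
  rw [PowerSeries.subst_mul hX, PowerSeries.subst_pow hX, PowerSeries.subst_X hX]
  refine le_trans ?_ (le_weightedOrder_mul _)
  refine le_trans ?_ le_self_add
  rw [weightedOrder_pow_eq]
  calc (M : ℕ∞) * h.order = (h.order.toNat : ℕ∞) * M := by rw [ENat.coe_toNat hfin, mul_comm]
    _ ≤ (h.order.toNat : ℕ∞) * weightedOrder ![M, N] (X (0 : Fin 2) : MvPowerSeries (Fin 2) k) := by
        gcongr
        exact le_weightedOrder_X_zero M N

/-- `N ≤ ord_{![M,N]}(x₁ + h(x₀))` when `N ≤ M · ord h` (the sheared letter keeps weight `N`). -/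
theorem le_weightedOrder_shift_one (M N : ℕ) (h : PowerSeries k) (hMN : (N : ℕ∞) ≤ M * h.order) :
    (N : ℕ∞) ≤ weightedOrder ![M, N] (PurePowerFlag.shift h 1) := by
  have h1 : PurePowerFlag.shift h 1 =
      (X (1 : Fin 2) : MvPowerSeries (Fin 2) k) + PowerSeries.subst (X (0 : Fin 2) : MvPowerSeries (Fin 2) k) h := by
    simp [PurePowerFlag.shift]
  rw [h1]
  refine le_trans (le_min (le_weightedOrder_X_one M N) (hMN.trans (mul_order_le_weightedOrder_subst_X_zero M N h)))
    (min_weightedOrder_le_add _)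

/-- `M ≤ ord_{![M,N]}` of the unchanged letter `x₀` of the shear. -/
theorem le_weightedOrder_shift_zero (M N : ℕ) (h : PowerSeries k) :
    (M : ℕ∞) ≤ weightedOrder ![M, N] (PurePowerFlag.shift h 0) := by
  have h0 : PurePowerFlag.shift h 0 = (X (0 : Fin 2) : MvPowerSeries (Fin 2) k) := by
    simp [PurePowerFlag.shift]
  rw [h0]
  exact le_weightedOrder_X_zero M N

/-! ### The shear does not lower the line-weighted order -/

/-- **PER17 LEMMA 5.3.3 (1), PLANE-SHEAR HALF** («`ord h ≥ s/d!` ⇒ `ord J̃₋₂ ≥ ord J₋₂`», weighted-order form): if `N ≤ M · ord h` then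
the shear `x₁ ↦ x₁ + h(x₀)` does not lower the `![M, N]`-weighted order of any series.
[cite: Perlega2020, Lemma 5.3.3 (1) (arXiv:2011.14443 Ch. 5 §3, p0064 L38–L47); HauserPerlega2024, Lemma 3 p. 791] -/
theorem le_weightedOrder_subst_shift (M N : ℕ) {h : PowerSeries k} (hh : PowerSeries.constantCoeff h = 0)
    (hMN : (N : ℕ∞) ≤ M * h.order) (F : MvPowerSeries (Fin 2) k) :
    weightedOrder ![M, N] F ≤ weightedOrder ![M, N] (subst (PurePowerFlag.shift h) F) := by
  have hθ : HasSubst (PurePowerFlag.shift h) := HauserPerlega2024.hasSubst_shift (0 : Fin 2) 1 h hh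
  refine le_trans ?_ (le_weightedOrder_subst _ hθ F)
  refine le_iInf₂ fun e he => (weightedOrder_le _ he).trans ?_
  have h0 := le_weightedOrder_shift_zero M N h (k := k)
  have h1 := le_weightedOrder_shift_one M N h hMN
  rw [WeightedShear.weight_fin_two, Finsupp.weight_apply, Finsupp.sum_fintype _ _ (fun i => by simp), Fin.sum_univ_two]
  simp only [Function.comp_apply, nsmul_eq_mul]
  push_cast
  calc (M : ℕ∞) * ((e 0 : ℕ) : ℕ∞) + (N : ℕ∞) * ((e 1 : ℕ) : ℕ∞)
      = ((e 0 : ℕ) : ℕ∞) * M + ((e 1 : ℕ) : ℕ∞) * N := by ring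
    _ ≤ ((e 0 : ℕ) : ℕ∞) * weightedOrder ![M, N] (PurePowerFlag.shift h 0) +
          ((e 1 : ℕ) : ℕ∞) * weightedOrder ![M, N] (PurePowerFlag.shift h 1) := by gcongr

/-- **THE SHEAR PRESERVES THE LINE-WEIGHTED ORDER** when `N ≤ M · ord h`: the inverse shear `x₁ ↦ x₁ − h(x₀)` has the same order, so
neither direction lowers `ord_{![M,N]}` (Per17 Lemma 5.3.3 (1)–(2), plane-shear half, sharpened: equality of orders already for
`ord h ≥ s/d!`; only the initial forms need the strict inequality).
[cite: Perlega2020, Lemma 5.3.3 (1)–(2) (arXiv:2011.14443 Ch. 5 §3, p0064 L38–L50)] -/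
theorem weightedOrder_subst_shift (M N : ℕ) {h : PowerSeries k} (hh : PowerSeries.constantCoeff h = 0)
    (hMN : (N : ℕ∞) ≤ M * h.order) (F : MvPowerSeries (Fin 2) k) :
    weightedOrder ![M, N] (subst (PurePowerFlag.shift h) F) = weightedOrder ![M, N] F := by
  refine le_antisymm ?_ (le_weightedOrder_subst_shift M N hh hMN F)
  have hneg : PowerSeries.constantCoeff (-h) = 0 := by rw [map_neg, hh, neg_zero]
  have hMN' : (N : ℕ∞) ≤ M * (-h).order := by rwa [PowerSeries.order_neg]
  have h1 := le_weightedOrder_subst_shift M N hneg hMN' (subst (PurePowerFlag.shift h) F)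
  have h2 : subst (PurePowerFlag.shift (-h)) (subst (PurePowerFlag.shift h) F) = F := by
    have h3 : subst (PurePowerFlag.shift (-h)) (subst (PurePowerFlag.shift h) F) = subst (PurePowerFlag.shift (h + -h)) F :=
      HauserPerlega2024.subst_shift_subst_shift (0 : Fin 2) 1 (by decide) h (-h) hh hneg F
    rw [h3, add_neg_cancel]
    exact HauserPerlega2024.subst_shift_zero (0 : Fin 2) 1 F
  rwa [h2] at h1

/-! ### Monic tuples sheared slotwise -/

variable {d : ℕ}

/-- The scaled slot orders do not drop under a shear on or above the line. -/
theorem slotWOrd_le_slotWOrd_shear (M N : ℕ) {h : PowerSeries k} (hh : PowerSeries.constantCoeff h = 0)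
    (hMN : (N : ℕ∞) ≤ M * h.order) (A : Fin d → MvPowerSeries (Fin 2) k) (j : Fin d) :
    slotWOrd ![M, N] A j ≤ slotWOrd ![M, N] (fun i => subst (PurePowerFlag.shift h) (A i)) j := by
  unfold slotWOrd
  gcongr
  exact le_weightedOrder_subst_shift M N hh hMN (A j)

/-- **`wMin` DOES NOT DROP UNDER A SHEAR ON OR ABOVE THE LINE**: `wMin ![M,N] A ≤ wMin ![M,N] (θ_h^* A)` when `N ≤ M · ord h` — with
stub-7's dictionary `natCast_le_sFlag_iff_le_wMin` (`w_s = ![δ!, s]`, condition `s ≤ δ! · ord h`) the tuple form of «`ord h ≥ s/d!` does not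
lower `s`» as far as the weighted order is concerned. [cite: Perlega2020, Lemma 5.3.3 (1) (arXiv:2011.14443 Ch. 5 §3, p0064 L38–L47)] -/
theorem wMin_le_wMin_shear (M N : ℕ) {h : PowerSeries k} (hh : PowerSeries.constantCoeff h = 0)
    (hMN : (N : ℕ∞) ≤ M * h.order) (A : Fin d → MvPowerSeries (Fin 2) k) :
    wMin ![M, N] A ≤ wMin ![M, N] (fun i => subst (PurePowerFlag.shift h) (A i)) :=
  le_iInf fun j => le_trans (iInf_le _ j) (slotWOrd_le_slotWOrd_shear M N hh hMN A j)

/-- The scaled slot orders are unchanged by a shear on or above the line. -/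
theorem slotWOrd_shear (M N : ℕ) {h : PowerSeries k} (hh : PowerSeries.constantCoeff h = 0)
    (hMN : (N : ℕ∞) ≤ M * h.order) (A : Fin d → MvPowerSeries (Fin 2) k) (j : Fin d) :
    slotWOrd ![M, N] (fun i => subst (PurePowerFlag.shift h) (A i)) j = slotWOrd ![M, N] A j := by
  unfold slotWOrd
  rw [weightedOrder_subst_shift M N hh hMN (A j)]

/-- **`wMin` IS UNCHANGED BY A SHEAR ON OR ABOVE THE LINE**: `wMin ![M,N] (θ_h^* A) = wMin ![M,N] A` when `N ≤ M · ord h`.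
[cite: Perlega2020, Lemma 5.3.3 (1)–(2) (arXiv:2011.14443 Ch. 5 §3, p0064 L38–L50)] -/
theorem wMin_shear (M N : ℕ) {h : PowerSeries k} (hh : PowerSeries.constantCoeff h = 0)
    (hMN : (N : ℕ∞) ≤ M * h.order) (A : Fin d → MvPowerSeries (Fin 2) k) :
    wMin ![M, N] (fun i => subst (PurePowerFlag.shift h) (A i)) = wMin ![M, N] A := by
  unfold wMin
  exact iInf_congr fun j => slotWOrd_shear M N hh hMN A j

/-! ### Through the dictionary: the shear and `sFlag` -/

/-- **PER17 LEMMA 5.3.3 (1)–(2), PLANE-SHEAR HALF, ON `s = sFlag`**: for a shear with `s ≤ δ! · ord h` preserving the setting `(δ, r)`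
(`hδ`, `hr`), «all reduced points on or above the `s`-line» holds after the shear iff it held before — res-D-pv-005 AS stub-7's dictionary
`natCast_le_sFlag_iff_le_wMin` (`w_s = ![δ!, s]`) and `wMin_shear`.
[cite: Perlega2020, Lemma 5.3.3 (1)–(2) (arXiv:2011.14443 Ch. 5 §3, p0064 L38–L50)] -/
theorem natCast_le_sFlag_shear_iff (E E' : Finset (Fin 2)) (A : Fin d → MvPowerSeries (Fin 2) k) {h : PowerSeries k}
    (hh : PowerSeries.constantCoeff h = 0) {s : ℕ} (hsh : (s : ℕ∞) ≤ ((dRes E (newtonSet A)).factorial : ℕ∞) * h.order)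
    (hδ : dRes E' (newtonSet (fun i => subst (PurePowerFlag.shift h) (A i))) = dRes E (newtonSet A))
    (hr : excExp E' (newtonSet (fun i => subst (PurePowerFlag.shift h) (A i))) = excExp E (newtonSet A)) :
    (s : ℕ∞) ≤ sFlag E' (newtonSet (fun i => subst (PurePowerFlag.shift h) (A i))) ↔ (s : ℕ∞) ≤ sFlag E (newtonSet A) := by
  rw [natCast_le_sFlag_iff_le_wMin, natCast_le_sFlag_iff_le_wMin, hδ, hr, wMin_shear _ s hh hsh A]

/-- Hence a shear with `s < δ! · ord h` (i.e. `s + 1 ≤ δ! · ord h`) preserving the setting preserves a finite `s = sFlag` EXACTLY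
(Per17 Lemma 5.3.3 (2), plane-shear half). [cite: Perlega2020, Lemma 5.3.3 (2) (arXiv:2011.14443 Ch. 5 §3, p0064 L44–L50)] -/
theorem sFlag_shear_eq (E E' : Finset (Fin 2)) (A : Fin d → MvPowerSeries (Fin 2) k) {h : PowerSeries k}
    (hh : PowerSeries.constantCoeff h = 0) {s : ℕ} (hs : sFlag E (newtonSet A) = s)
    (hsh : ((s + 1 : ℕ) : ℕ∞) ≤ ((dRes E (newtonSet A)).factorial : ℕ∞) * h.order)
    (hδ : dRes E' (newtonSet (fun i => subst (PurePowerFlag.shift h) (A i))) = dRes E (newtonSet A))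
    (hr : excExp E' (newtonSet (fun i => subst (PurePowerFlag.shift h) (A i))) = excExp E (newtonSet A)) :
    sFlag E' (newtonSet (fun i => subst (PurePowerFlag.shift h) (A i))) = s := by
  have hsh' : (s : ℕ∞) ≤ ((dRes E (newtonSet A)).factorial : ℕ∞) * h.order :=
    le_trans (by exact_mod_cast Nat.le_succ s) hsh
  have h1 : (s : ℕ∞) ≤ sFlag E' (newtonSet (fun i => subst (PurePowerFlag.shift h) (A i))) :=
    (natCast_le_sFlag_shear_iff E E' A hh hsh' hδ hr).2 hs.ge
  have h2 : ¬ ((s + 1 : ℕ) : ℕ∞) ≤ sFlag E' (newtonSet (fun i => subst (PurePowerFlag.shift h) (A i))) := by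
    rw [natCast_le_sFlag_shear_iff E E' A hh hsh hδ hr, hs, Nat.cast_le]
    omega
  refine le_antisymm ?_ h1
  rw [not_le, Nat.cast_add, Nat.cast_one, ENat.lt_add_one_iff (ENat.coe_ne_top s)] at h2
  exact h2

/-- And a shear with `s ≤ δ! · ord h` preserving the setting does not LOWER a (possibly infinite) `sFlag ≥ s`
(Per17 Lemma 5.3.3 (1), plane-shear half). [cite: Perlega2020, Lemma 5.3.3 (1) (arXiv:2011.14443 Ch. 5 §3, p0064 L38–L43)] -/
theorem le_sFlag_shear (E E' : Finset (Fin 2)) (A : Fin d → MvPowerSeries (Fin 2) k) {h : PowerSeries k}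
    (hh : PowerSeries.constantCoeff h = 0) {s : ℕ} (hs : (s : ℕ∞) ≤ sFlag E (newtonSet A))
    (hsh : (s : ℕ∞) ≤ ((dRes E (newtonSet A)).factorial : ℕ∞) * h.order)
    (hδ : dRes E' (newtonSet (fun i => subst (PurePowerFlag.shift h) (A i))) = dRes E (newtonSet A))
    (hr : excExp E' (newtonSet (fun i => subst (PurePowerFlag.shift h) (A i))) = excExp E (newtonSet A)) :
    (s : ℕ∞) ≤ sFlag E' (newtonSet (fun i => subst (PurePowerFlag.shift h) (A i))) :=
  (natCast_le_sFlag_shear_iff E E' A hh hsh hδ hr).2 hs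

end WildMonic

end Summit.ResolutionOfSingularities.ResolutionOfSingularities.Theorems
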